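import Literature.NumberTheory.Automorphic.UnitaryGroupCongruenceLevels
import Literature.AlgebraicGeometry.ShimuraVarieties.PrincipalCongruenceSubgroupTorsionFree
import HarnessLib

/-!
# Arithmetic levels `Γ(K) = U(J)(F) ∩ K` of a unitary group

Registry: pub-hodgecm MODEL-CONSTRUCTION sub-cell, MODEL-DAG node **U2** (x) — endorsed sub-node (carver
ruling): the arithmetic subgroup cut out of the rational points `U(J)(F) ≤ GL_N(E)` by a compact open subgroup
`K ≤ U(J)(𝔸_{F,f})`, in the exact currency of the tree's ball-quotient datum
(`ShimuraVarieties.IsCongruenceSubgroup`, `principalCongruenceSubgroup`, torsion-freeness).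

For a quadratic extension `E/F` of number fields with involution `c` and any `J ∈ M_N(E)`:

* `rationalToFinAdelic : rational F E c N J →* finAdelic F E c N J`, the diagonal embedding
  `U(J)(F) → U(J)(𝔸_{F,f})` (`GL_N` of `E → 𝔸_E^∞`); its `w`-components are the entries read in `E_w`.
* **`arithmeticLevel K : Subgroup (GL (Fin N) E)`** = `Γ(K) = {γ ∈ U(J)(F) ∣ γ ∈ K}` for
  `K : Subgroup (finAdelic …)`; monotone in `K` (`arithmeticLevel_mono` — the `cover` maps
  `Γ(K') ≤ Γ(K)` for `K' ≤ K`), `arithmeticLevel ⊤ = rational`, and the homomorphism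
  `arithmeticLevelToLevel K : Γ(K) →* K`.
* **Principal levels are the classical principal congruence subgroups**
  (`arithmeticLevel_finCongruenceLevel_span`): for `0 < n`,
  `Γ(K_{U,f}(n𝓞_E)) = principalCongruenceSubgroup c J n = {γ ∈ U(J)(F) ∣ γ, γ⁻¹ ≡ 1 mod n, integrally}`
  — the local–global principle for integrality (`x ∈ 𝓞_E ⇔ |x|_w ≤ 1` for all finite `w`, Mathlib
  `HeightOneSpectrum.mem_integers_of_valuation_le_one`) entry by entry
  (`isCongruentOneMod_iff_forall_valuation`).
* `finCongruenceLevel_mono` (`0 ≠ 𝔫 ⊆ 𝔪 → K_{U,f}(𝔫) ≤ K_{U,f}(𝔪)`, via `|𝔫|_w ≤ |𝔪|_w`) and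
  `finCongruenceLevel_span_absNorm_le` (`K_{U,f}(N(𝔫)𝓞_E) ≤ K_{U,f}(𝔫)`: every ideal level contains an
  integer level).
* **`isCongruenceSubgroup_arithmeticLevel`** (`_of_le` for ideal levels): if `K` is compact and contains
  `K_{U,f}(n𝓞_E)` for some `n > 0` (resp. `K_{U,f}(𝔫)`, `𝔫 ≠ 0`) then `Γ(K)` is a congruence subgroup in the sense of `ShimuraVarieties.IsCongruenceSubgroup c J`
  (contains `Γ(n)` with finite index: an open subgroup meets a compact one with finite index);
  **`torsionFree_arithmeticLevel`**: if `K ≤ K_{U,f}(n𝓞_E)` with `3 ≤ n` then `Γ(K)` is torsion-free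
  (Minkowski, tree `torsionFree_of_le_principalCongruenceSubgroup`).
* CM dictionary (`E ⊂ ℂ` a CM field, `F = E⁺`, `c` = complex conjugation):
  `rational E⁺ E c̄ N H = ShimuraVarieties.unitaryGroup (conjRingHom E) H` and the two theorems restated
  with `conjRingHom E` — the hypothesis shape of `PicardCM.BallQuotientUniformised`.

All statements are proved (no records). References: Platonov–Rapinchuk 1994 §4.1 & §5.1 (arithmetic and
congruence subgroups `G(K) ∩ K_f`, principal congruence subgroups); Bergeron–Millson–Moeglin 2016,
Introduction §1.1 (`Γ = G(ℚ) ∩ K`).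
-/

noncomputable section

open NumberField IsDedekindDomain Topology
open scoped Matrix MatrixGroups

namespace Literature.NumberTheory.Automorphic

/-! ## 0. Generic helpers -/

section Helpers

/-- The tree's two renderings of the unitary group of a form — `ShimuraVarieties.unitaryGroup σ H`
(ball-quotient datum) and `unitaryGroupOfForm σ H` (automorphic side) — are the same subgroup of `GL_m(R)`.
[folklore] -/
theorem _root_.Literature.AlgebraicGeometry.ShimuraVarieties.unitaryGroup_eq_unitaryGroupOfForm
    {R : Type} [CommRing R] {m : Type*} [Fintype m] [DecidableEq m] (σ : R →+* R) (H : Matrix m m R) :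
    Literature.AlgebraicGeometry.ShimuraVarieties.unitaryGroup σ H = unitaryGroupOfForm σ H :=
  Subgroup.ext fun _ => by
    rw [Literature.AlgebraicGeometry.ShimuraVarieties.mem_unitaryGroup_iff, mem_unitaryGroupOfForm_iff]

/-- Membership in `principalCongruenceSubgroup σ H n` (definitional unfolding). [folklore] -/
theorem _root_.Literature.AlgebraicGeometry.ShimuraVarieties.mem_principalCongruenceSubgroup_iff
    {E : Type*} [Field E] {m : Type*} [Fintype m] [DecidableEq m] (σ : E →+* E) (H : Matrix m m E) (n : ℕ)
    (g : GL m E) :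
    g ∈ Literature.AlgebraicGeometry.ShimuraVarieties.principalCongruenceSubgroup σ H n ↔
      g ∈ Literature.AlgebraicGeometry.ShimuraVarieties.unitaryGroup σ H ∧
        Literature.AlgebraicGeometry.ShimuraVarieties.IsCongruentOneMod n (g : Matrix m m E) ∧
        Literature.AlgebraicGeometry.ShimuraVarieties.IsCongruentOneMod n ((g⁻¹ : GL m E) : Matrix m m E) :=
  Iff.rfl

/-- Every principal congruence subgroup `Γ(n)`, `n > 0`, is a congruence subgroup. [folklore] -/
theorem _root_.Literature.AlgebraicGeometry.ShimuraVarieties.isCongruenceSubgroup_principalCongruenceSubgroup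
    {E : Type*} [Field E] {m : Type*} [Fintype m] [DecidableEq m] (σ : E →+* E) (H : Matrix m m E) {n : ℕ}
    (hn : 0 < n) :
    Literature.AlgebraicGeometry.ShimuraVarieties.IsCongruenceSubgroup σ H
      (Literature.AlgebraicGeometry.ShimuraVarieties.principalCongruenceSubgroup σ H n) := by
  refine ⟨fun g hg => hg.1, n, hn, le_rfl, ?_⟩
  rw [Subgroup.subgroupOf_self]
  infer_instance

/-- The preimage of a finite-index subgroup has finite index (`G'/f⁻¹H ↪ G/H`). [folklore] -/
theorem _root_.Subgroup.finiteIndex_comap_of_finiteIndex {G G' : Type*} [Group G] [Group G'] (f : G' →* G)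
    (H : Subgroup G) [H.FiniteIndex] : (H.comap f).FiniteIndex := by
  rw [Subgroup.finiteIndex_iff, Subgroup.index_comap]
  exact (Subgroup.instFiniteIndex_subgroupOf H f.range).index_ne_zero

end Helpers

/-! ## 1. Local–global integrality and congruences -/

section LocalGlobal

variable {E : Type} [Field E] [NumberField E]

/-- `|r𝓞_E|_w = |r|_w`: the radius of the principal ideal `(r)` at `w` is the valuation of `r`. [folklore] -/
theorem idealRadius_span_singleton {r : 𝓞 E} (hr : r ≠ 0) (w : HeightOneSpectrum (𝓞 E)) :
    idealRadius E w (Ideal.span {r}) = w.valuation E (r : E) := by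
  have h0 : (Ideal.span {r} : Ideal (𝓞 E)) ≠ 0 := by
    rwa [Ne, Ideal.zero_eq_bot, Ideal.span_singleton_eq_bot]
  rw [idealRadius, FractionalIdeal.count_coe E w h0, HeightOneSpectrum.valuation_of_algebraMap,
    HeightOneSpectrum.intValuation_if_neg w hr]

/-- `|𝔫|_w ≤ |𝔪|_w` for `0 ≠ 𝔫 ⊆ 𝔪` (the radius grows with the ideal). Local copy of the tree's
`idealRadius_mono` (`UnramifiedHeckeLevel.lean`, not imported here to keep the import closure small). [folklore] -/
private theorem idealRadius_mono_aux {𝔫 𝔪 : Ideal (𝓞 E)} (h𝔫 : 𝔫 ≠ 0) (h : 𝔫 ≤ 𝔪) (w : HeightOneSpectrum (𝓞 E)) :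
    idealRadius E w 𝔫 ≤ idealRadius E w 𝔪 := by
  rw [idealRadius, idealRadius, WithZero.exp_le_exp, neg_le_neg_iff]
  refine FractionalIdeal.count_mono E w ?_ ((FractionalIdeal.coeIdeal_le_coeIdeal E).2 h)
  rwa [Ne, FractionalIdeal.coeIdeal_eq_zero, ← Ideal.zero_eq_bot]

/-- **Local–global divisibility**: `x ∈ E` is `r` times an algebraic integer iff `|x|_w ≤ |r|_w` at every
finite place (`r ≠ 0`; Mathlib `mem_integers_of_valuation_le_one` applied to `x / r`). [folklore] -/
theorem exists_eq_mul_iff_forall_valuation_le {r : 𝓞 E} (hr : r ≠ 0) (x : E) :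
    (∃ a : 𝓞 E, x = (r : E) * a) ↔
      ∀ w : HeightOneSpectrum (𝓞 E), w.valuation E x ≤ w.valuation E (r : E) := by
  have hr' : (r : E) ≠ 0 := by exact_mod_cast hr
  constructor
  · rintro ⟨a, rfl⟩ w
    rw [map_mul]
    calc w.valuation E (r : E) * w.valuation E (a : E)
        ≤ w.valuation E (r : E) * 1 := by gcongr; exact HeightOneSpectrum.valuation_le_one w a
      _ = w.valuation E (r : E) := mul_one _
  · intro h
    have h1 : ∀ w : HeightOneSpectrum (𝓞 E), w.valuation E (x / r) ≤ 1 := fun w => by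
      have hv : w.valuation E (r : E) ≠ 0 := (Valuation.ne_zero_iff _).2 hr'
      rw [map_div₀]
      exact div_le_one_of_le₀ (h w) zero_le
    obtain ⟨a, ha⟩ := HeightOneSpectrum.mem_integers_of_valuation_le_one E (x / r) h1
    refine ⟨a, ?_⟩
    rw [show ((a : 𝓞 E) : E) = x / r from ha, mul_div_cancel₀ _ hr']

variable {N : ℕ}

open Literature.AlgebraicGeometry.ShimuraVarieties in
/-- **`g ≡ 1 (mod n)` integrally iff `|(g - 1)_{ij}|_w ≤ |n|_w` for all entries and all finite places.**
[folklore] -/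
theorem isCongruentOneMod_iff_forall_valuation {n : ℕ} (hn : n ≠ 0) (M : Matrix (Fin N) (Fin N) E) :
    IsCongruentOneMod n M ↔ ∀ i j, ∀ w : HeightOneSpectrum (𝓞 E),
      w.valuation E ((M - 1) i j) ≤ w.valuation E (n : E) := by
  have hn' : ((n : 𝓞 E)) ≠ 0 := by exact_mod_cast hn
  have hcast : (((n : 𝓞 E) : 𝓞 E) : E) = (n : E) := by simp
  constructor
  · rintro ⟨A, hA⟩ i j w
    have hij : (M - 1) i j = (n : E) * algebraMap (𝓞 E) E (A i j) := by
      rw [hA, add_sub_cancel_left, Matrix.smul_apply, Matrix.map_apply, nsmul_eq_mul]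
    rw [hij, ← hcast]
    exact (exists_eq_mul_iff_forall_valuation_le hn' _).1 ⟨A i j, rfl⟩ w
  · intro h
    have hex : ∀ i j, ∃ a : 𝓞 E, (M - 1) i j = (n : E) * a := fun i j => by
      rw [← hcast]
      exact (exists_eq_mul_iff_forall_valuation_le hn' _).2 (fun w => hcast ▸ h i j w)
    choose A hA using hex
    refine ⟨Matrix.of A, Matrix.ext fun i j => ?_⟩
    have hij := hA i j
    rw [Matrix.sub_apply, sub_eq_iff_eq_add'] at hij
    rw [hij, Matrix.add_apply, Matrix.smul_apply, Matrix.map_apply, Matrix.of_apply, nsmul_eq_mul]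

open Literature.AlgebraicGeometry.ShimuraVarieties in
/-- A matrix `≡ 1 (mod n)` integrally has integral entries: `|g_{ij}|_w ≤ 1`. [folklore] -/
theorem _root_.Literature.AlgebraicGeometry.ShimuraVarieties.IsCongruentOneMod.valuation_apply_le_one {n : ℕ} {M : Matrix (Fin N) (Fin N) E}
    (hM : IsCongruentOneMod n M) (i j : Fin N) (w : HeightOneSpectrum (𝓞 E)) :
    w.valuation E (M i j) ≤ 1 := by
  obtain ⟨A, rfl⟩ := hM
  have : ((1 : Matrix (Fin N) (Fin N) E) + n • A.map (algebraMap (𝓞 E) E)) i j =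
      algebraMap (𝓞 E) E ((1 + n • A) i j) := by
    rw [Matrix.add_apply, Matrix.add_apply, Matrix.smul_apply, Matrix.smul_apply, Matrix.map_apply,
      map_add, map_nsmul, Matrix.one_apply, Matrix.one_apply]
    split_ifs <;> simp
  rw [this]
  exact HeightOneSpectrum.valuation_le_one w _

end LocalGlobal

namespace UnitaryGroup

variable (F E : Type) [Field F] [NumberField F] [Field E] [NumberField E] [Algebra F E]
  (c : E ≃ₐ[F] E) (N : ℕ) (J : Matrix (Fin N) (Fin N) E)

/-! ## 2. The diagonal embedding `U(J)(F) → U(J)(𝔸_{F,f})` -/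

omit [NumberField F] in
/-- `(c x)_{𝔸_f} = (c ⊗ 1)(x_{𝔸_f})`. [folklore] -/
theorem algebraMap_galConj_finiteAdele (x : E) :
    algebraMap E (FiniteAdeleRing (𝓞 E) E) ((c : E →+* E) x) =
      conjFiniteAdele F E c (algebraMap E (FiniteAdeleRing (𝓞 E) E) x) := by
  rw [conjFiniteAdele_apply, FiniteAdeleRing.smul_algebraMap]
  rfl

/-- **The diagonal embedding `U(J)(F) →* U(J)(𝔸_{F,f})`**, `γ ↦ (γ)_w` (`GL_N` of `E → 𝔸_E^∞`).
Platonov–Rapinchuk 1994, §5.1. [cite: PlatonovRapinchuk1994, §5.1] -/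
def rationalToFinAdelic : rational F E c N J →* finAdelic F E c N J :=
  unitaryGroupOfFormMap (σ := (c : E →+* E)) (τ := conjFiniteAdele F E c)
    (algebraMap E (FiniteAdeleRing (𝓞 E) E)) (algebraMap_galConj_finiteAdele F E c) J

omit [NumberField F] in
/-- Underlying matrix of `rationalToFinAdelic γ`: `GL_N(E → 𝔸_E^∞) γ`. [folklore] -/
@[simp] theorem coe_rationalToFinAdelic (g : rational F E c N J) :
    ((rationalToFinAdelic F E c N J g : finAdelic F E c N J) : GL (Fin N) (FiniteAdeleRing (𝓞 E) E)) =
      Matrix.GeneralLinearGroup.map (algebraMap E (FiniteAdeleRing (𝓞 E) E)) (g : GL (Fin N) E) :=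
  rfl

variable {N} in
omit [NumberField F] in
/-- **Components of the diagonal**: `(γ)_w = GL_N(E → E_w) γ`, i.e. the entries of `γ` read in `E_w`. [folklore] -/
theorem evalAt_rationalToFinAdelic (w : HeightOneSpectrum (𝓞 E)) (g : rational F E c N J) :
    GLn.evalAt N E w (rationalToFinAdelic F E c N J g : finAdelic F E c N J) =
      Matrix.GeneralLinearGroup.map (algebraMap E (w.adicCompletion E)) (g : GL (Fin N) E) :=
  Units.ext <| Matrix.ext fun _ _ => rfl

/-! ## 3. Arithmetic levels -/

/-- **The arithmetic level `Γ(K) = U(J)(F) ∩ K ≤ GL_N(E)`** cut out by a subgroup `K ≤ U(J)(𝔸_{F,f})`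
(interesting for `K` compact open). Platonov–Rapinchuk 1994, §4.1 ("`G_{𝒪(S)} = G_K ∩ …`", arithmetic and
congruence subgroups); BMM Introduction §1.1 (`Γ = G(ℚ) ∩ K`). [cite: PlatonovRapinchuk1994, §4.1] -/
def arithmeticLevel (K : Subgroup (finAdelic F E c N J)) : Subgroup (GL (Fin N) E) :=
  (K.comap (rationalToFinAdelic F E c N J)).map (rational F E c N J).subtype

variable {F E c N J}

omit [NumberField F] in
/-- Membership in `Γ(K)`: `γ ∈ U(J)(F)` and `(γ)_f ∈ K`. [folklore] -/
theorem mem_arithmeticLevel_iff {K : Subgroup (finAdelic F E c N J)} {g : GL (Fin N) E} :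
    g ∈ arithmeticLevel F E c N J K ↔
      ∃ hg : g ∈ rational F E c N J, rationalToFinAdelic F E c N J ⟨g, hg⟩ ∈ K := by
  constructor
  · rintro ⟨x, hx, rfl⟩
    exact ⟨x.2, hx⟩
  · rintro ⟨hg, h⟩
    exact ⟨⟨g, hg⟩, h, rfl⟩

omit [NumberField F] in
/-- `Γ(K) ≤ U(J)(F)`. [folklore] -/
theorem arithmeticLevel_le_rational (K : Subgroup (finAdelic F E c N J)) :
    arithmeticLevel F E c N J K ≤ rational F E c N J := fun _ hg =>
  (mem_arithmeticLevel_iff.1 hg).1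

omit [NumberField F] in
/-- **`cover` functoriality**: `K' ≤ K → Γ(K') ≤ Γ(K)`. [folklore] -/
theorem arithmeticLevel_mono {K K' : Subgroup (finAdelic F E c N J)} (h : K' ≤ K) :
    arithmeticLevel F E c N J K' ≤ arithmeticLevel F E c N J K :=
  Subgroup.map_mono (Subgroup.comap_mono h)

omit [NumberField F] in
/-- `Γ(⊤) = U(J)(F)`. [folklore] -/
@[simp] theorem arithmeticLevel_top : arithmeticLevel F E c N J ⊤ = rational F E c N J := by
  rw [arithmeticLevel, Subgroup.comap_top, ← MonoidHom.range_eq_map, Subgroup.range_subtype]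

omit [NumberField F] in
/-- `Γ(K ∩ K') = Γ(K) ∩ Γ(K')`. [folklore] -/
theorem arithmeticLevel_inf (K K' : Subgroup (finAdelic F E c N J)) :
    arithmeticLevel F E c N J (K ⊓ K') = arithmeticLevel F E c N J K ⊓ arithmeticLevel F E c N J K' := by
  ext g
  simp only [Subgroup.mem_inf, mem_arithmeticLevel_iff]
  exact ⟨fun ⟨hg, h₁, h₂⟩ => ⟨⟨hg, h₁⟩, ⟨hg, h₂⟩⟩, fun ⟨⟨hg, h₁⟩, ⟨_, h₂⟩⟩ => ⟨hg, h₁, h₂⟩⟩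

variable (F E c N J) in
/-- The homomorphism `Γ(K) →* K`, `γ ↦ (γ)_f`. [folklore] -/
def arithmeticLevelToLevel (K : Subgroup (finAdelic F E c N J)) : arithmeticLevel F E c N J K →* K where
  toFun g := ⟨rationalToFinAdelic F E c N J ⟨g.1, (mem_arithmeticLevel_iff.1 g.2).1⟩,
    (mem_arithmeticLevel_iff.1 g.2).2⟩
  map_one' := Subtype.ext <| by
    simp only [OneMemClass.coe_one]
    exact (map_one (rationalToFinAdelic F E c N J)).symm ▸ rfl
  map_mul' g h := Subtype.ext <| by
    simp only [Subgroup.coe_mul]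
    rw [← map_mul]
    rfl

omit [NumberField F] in
/-- `arithmeticLevelToLevel` on underlying finite-adelic points. [folklore] -/
@[simp] theorem coe_arithmeticLevelToLevel_apply (K : Subgroup (finAdelic F E c N J))
    (g : arithmeticLevel F E c N J K) :
    ((arithmeticLevelToLevel F E c N J K g : K) : finAdelic F E c N J) =
      rationalToFinAdelic F E c N J ⟨g.1, (mem_arithmeticLevel_iff.1 g.2).1⟩ :=
  rfl

omit [NumberField F] in
/-- For `K' ≤ U(J)(𝔸_{F,f})` arbitrary: `Γ(K') ∩ Γ(K)`, as a subgroup of `Γ(K)`, is the preimage of `K' ∩ K`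
under `Γ(K) → K`. [folklore] -/
theorem arithmeticLevel_subgroupOf (K K' : Subgroup (finAdelic F E c N J)) :
    (arithmeticLevel F E c N J K').subgroupOf (arithmeticLevel F E c N J K) =
      (K'.subgroupOf K).comap (arithmeticLevelToLevel F E c N J K) := by
  ext g
  rw [Subgroup.mem_subgroupOf, Subgroup.mem_comap, Subgroup.mem_subgroupOf, coe_arithmeticLevelToLevel_apply,
    mem_arithmeticLevel_iff]
  exact ⟨fun ⟨_, h⟩ => h, fun h => ⟨_, h⟩⟩

/-! ## 4. Principal levels are the classical principal congruence subgroups -/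

omit [NumberField F] in
/-- At a finite place `w`: `GL_N(E → E_w) g` lies in the valued congruence subgroup of radius `|n|_w` iff the
entries of `g`, `g⁻¹` are `w`-integral and those of `g - 1` have `|·|_w ≤ |n|_w`. [folklore] -/
theorem map_mem_valuedCongruenceSubgroup_iff {n : ℕ} (hn : n ≠ 0) (w : HeightOneSpectrum (𝓞 E))
    (g : GL (Fin N) E) :
    Matrix.GeneralLinearGroup.map (algebraMap E (w.adicCompletion E)) g ∈
        valuedCongruenceSubgroup (Fin N) (idealRadius E w (Ideal.span {(n : 𝓞 E)})) ↔
      (∀ i j, w.valuation E ((g : Matrix (Fin N) (Fin N) E) i j) ≤ 1) ∧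
        (∀ i j, w.valuation E (((g⁻¹ : GL (Fin N) E) : Matrix (Fin N) (Fin N) E) i j) ≤ 1) ∧
        ∀ i j, w.valuation E (((g : Matrix (Fin N) (Fin N) E) - 1) i j) ≤ w.valuation E (n : E) := by
  have hn' : ((n : 𝓞 E)) ≠ 0 := by exact_mod_cast hn
  have hrad : idealRadius E w (Ideal.span {(n : 𝓞 E)}) = w.valuation E (n : E) := by
    rw [idealRadius_span_singleton hn']; push_cast; rfl
  have hv : ∀ x : E, Valued.v (algebraMap E (w.adicCompletion E) x) = w.valuation E x := fun x =>
    HeightOneSpectrum.valuedAdicCompletion_eq_valuation' w x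
  have hentry : ∀ (g : GL (Fin N) E) (i j : Fin N),
      ((Matrix.GeneralLinearGroup.map (algebraMap E (w.adicCompletion E)) g : GL (Fin N) (w.adicCompletion E)) :
        Matrix (Fin N) (Fin N) (w.adicCompletion E)) i j =
        algebraMap E (w.adicCompletion E) ((g : Matrix (Fin N) (Fin N) E) i j) := fun _ _ _ => rfl
  have hsub : ((Matrix.GeneralLinearGroup.map (algebraMap E (w.adicCompletion E)) g :
      GL (Fin N) (w.adicCompletion E)) : Matrix (Fin N) (Fin N) (w.adicCompletion E)) - 1 =
      (((g : Matrix (Fin N) (Fin N) E)) - 1).map (algebraMap E (w.adicCompletion E)) := by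
    rw [Matrix.map_sub _ (map_sub _), Matrix.map_one _ (map_zero _) (map_one _)]
    rfl
  rw [mem_valuedCongruenceSubgroup_iff, ← map_inv, hsub, hrad]
  simp only [hentry, Matrix.map_apply, hv]

omit [NumberField F] in
/-- The principal finite congruence levels decrease with the level: `0 ≠ 𝔫 ⊆ 𝔪 → K_{U,f}(𝔫) ≤ K_{U,f}(𝔪)`.
[folklore] -/
theorem finCongruenceLevel_mono {𝔫 𝔪 : Ideal (𝓞 E)} (h𝔫 : 𝔫 ≠ 0) (h : 𝔫 ≤ 𝔪) :
    finCongruenceLevel F E c N J 𝔫 ≤ finCongruenceLevel F E c N J 𝔪 := fun g hg => by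
  rw [mem_finCongruenceLevel_iff_forall] at hg ⊢
  exact fun w => valuedCongruenceSubgroup_mono (m := Fin N) (h := idealRadius_mono_aux h𝔫 h w) (hg w)

omit [NumberField F] in
/-- `K_{U,f}(N(𝔫)𝓞_E) ≤ K_{U,f}(𝔫)` for `𝔫 ≠ 0`, since the absolute norm `N(𝔫) ∈ 𝔫` (Mathlib
`Ideal.absNorm_mem`): every ideal level contains an INTEGER level. [folklore] -/
theorem finCongruenceLevel_span_absNorm_le {𝔫 : Ideal (𝓞 E)} (h𝔫 : 𝔫 ≠ 0) :
    finCongruenceLevel F E c N J (Ideal.span {((Ideal.absNorm 𝔫 : ℕ) : 𝓞 E)}) ≤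
      finCongruenceLevel F E c N J 𝔫 := by
  refine finCongruenceLevel_mono ?_ ((Ideal.span_singleton_le_iff_mem _).2 (Ideal.absNorm_mem 𝔫))
  rw [Ne, Ideal.zero_eq_bot, Ideal.span_singleton_eq_bot]
  exact_mod_cast (Ideal.absNorm_eq_zero_iff.not.2 (by rwa [← Ideal.zero_eq_bot]))

omit [NumberField F] in
/-- Membership in the arithmetic level of a principal finite congruence level, placewise: `γ ∈ U(J)(F)` and
`GL_N(E → E_w) γ ∈ K_w(𝔫)` for every finite `w`. [folklore] -/
theorem mem_arithmeticLevel_finCongruenceLevel_iff (𝔫 : Ideal (𝓞 E)) (g : GL (Fin N) E) :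
    g ∈ arithmeticLevel F E c N J (finCongruenceLevel F E c N J 𝔫) ↔
      g ∈ rational F E c N J ∧ ∀ w : HeightOneSpectrum (𝓞 E),
        Matrix.GeneralLinearGroup.map (algebraMap E (w.adicCompletion E)) g ∈
          valuedCongruenceSubgroup (Fin N) (idealRadius E w 𝔫) := by
  rw [mem_arithmeticLevel_iff]
  constructor
  · rintro ⟨hg, h⟩
    rw [mem_finCongruenceLevel_iff_forall] at h
    exact ⟨hg, fun w => by have hw := h w; rwa [evalAt_rationalToFinAdelic] at hw⟩
  · rintro ⟨hg, h⟩
    refine ⟨hg, ?_⟩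
    rw [mem_finCongruenceLevel_iff_forall]
    exact fun w => by rw [evalAt_rationalToFinAdelic]; exact h w

omit [NumberField F] in
open Literature.AlgebraicGeometry.ShimuraVarieties in
/-- **`Γ(K_{U,f}(n𝓞_E)) = Γ(n)`**: the arithmetic level of the principal finite congruence level of level
`n𝓞_E` (`0 < n`) is the classical principal congruence subgroup `{γ ∈ U(J)(F) ∣ γ ≡ 1, γ⁻¹ ≡ 1 (mod n)}`
of the tree's ball-quotient datum. Platonov–Rapinchuk 1994, §4.1 (congruence subgroups `G_𝒪(𝔞) = G ∩ GL_n(𝒪, 𝔞)`).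
[cite: PlatonovRapinchuk1994, §4.1] -/
theorem arithmeticLevel_finCongruenceLevel_span {n : ℕ} (hn : n ≠ 0) :
    arithmeticLevel F E c N J (finCongruenceLevel F E c N J (Ideal.span {(n : 𝓞 E)})) =
      principalCongruenceSubgroup (c : E →+* E) J n := by
  ext g
  rw [mem_arithmeticLevel_finCongruenceLevel_iff, mem_principalCongruenceSubgroup_iff,
    unitaryGroup_eq_unitaryGroupOfForm]
  constructor
  · rintro ⟨hg, hK⟩
    refine ⟨hg, (isCongruentOneMod_iff_forall_valuation hn _).2 fun i j w => ?_,
      (isCongruentOneMod_iff_forall_valuation hn _).2 fun i j w => ?_⟩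
    · exact ((map_mem_valuedCongruenceSubgroup_iff hn w g).1 (hK w)).2.2 i j
    · have h := inv_mem (hK w)
      rw [← map_inv, map_mem_valuedCongruenceSubgroup_iff hn] at h
      exact h.2.2 i j
  · rintro ⟨hg, h₁, h₂⟩
    exact ⟨hg, fun w => (map_mem_valuedCongruenceSubgroup_iff hn w g).2
      ⟨fun i j => h₁.valuation_apply_le_one i j w, fun i j => h₂.valuation_apply_le_one i j w,
        fun i j => (isCongruentOneMod_iff_forall_valuation hn _).1 h₁ i j w⟩⟩

/-! ## 5. `Γ(K)` is a torsion-free congruence subgroup for deep compact open `K` -/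

omit [NumberField F] in
open Literature.AlgebraicGeometry.ShimuraVarieties in
/-- **`Γ(K)` is a congruence subgroup**: for `K ≤ U(J)(𝔸_{F,f})` compact with `K_{U,f}(n𝓞_E) ≤ K`, `0 < n`
(every compact OPEN `K` contains such a level), `Γ(K)` lies in `U(J)(F)` and contains `Γ(n)` with finite
index. Platonov–Rapinchuk 1994, §4.1; BMM Introduction §1.1. [cite: PlatonovRapinchuk1994, §4.1] -/
theorem isCongruenceSubgroup_arithmeticLevel {K : Subgroup (finAdelic F E c N J)}
    (hK : IsCompact (K : Set (finAdelic F E c N J))) {n : ℕ} (hn : n ≠ 0)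
    (hnK : finCongruenceLevel F E c N J (Ideal.span {(n : 𝓞 E)}) ≤ K) :
    IsCongruenceSubgroup (c : E →+* E) J (arithmeticLevel F E c N J K) := by
  have hn0 : (Ideal.span {(n : 𝓞 E)} : Ideal (𝓞 E)) ≠ 0 := by
    rw [Ne, Ideal.zero_eq_bot, Ideal.span_singleton_eq_bot]; exact_mod_cast hn
  refine ⟨?_, n, Nat.pos_of_ne_zero hn, ?_, ?_⟩
  · rw [unitaryGroup_eq_unitaryGroupOfForm]
    exact arithmeticLevel_le_rational K
  · rw [← arithmeticLevel_finCongruenceLevel_span hn]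
    exact arithmeticLevel_mono hnK
  · rw [← arithmeticLevel_finCongruenceLevel_span hn, arithmeticLevel_subgroupOf]
    -- an open subgroup meets the compact `K` with finite index (`K / (K ∩ K(n))` is compact and discrete;
    -- cf. the tree's `Subgroup.finiteIndex_subgroupOf_of_isCompact_isOpen` in `UnramifiedLevelChange`,
    -- not imported here to keep the import closure small)
    haveI : ((finCongruenceLevel F E c N J (Ideal.span {(n : 𝓞 E)})).subgroupOf K).FiniteIndex := by
      haveI : CompactSpace K := isCompact_iff_compactSpace.mp hK
      haveI : DiscreteTopology (K ⧸ (finCongruenceLevel F E c N J (Ideal.span {(n : 𝓞 E)})).subgroupOf K) :=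
        QuotientGroup.discreteTopology
          ((isOpen_finCongruenceLevel F E c N J hn0).preimage continuous_subtype_val)
      haveI : Finite (K ⧸ (finCongruenceLevel F E c N J (Ideal.span {(n : 𝓞 E)})).subgroupOf K) :=
        finite_of_compact_of_discrete
      exact Subgroup.finiteIndex_of_finite_quotient
    exact Subgroup.finiteIndex_comap_of_finiteIndex _ _

omit [NumberField F] in
open Literature.AlgebraicGeometry.ShimuraVarieties in
/-- **`Γ(K)` is a congruence subgroup — ideal-level form**: `K` compact with `K_{U,f}(𝔫) ≤ K` for some ideal
`𝔫 ≠ 0` (take `n = N(𝔫)`). In particular for every principal finite congruence level. [cite: PlatonovRapinchuk1994, §4.1] -/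
theorem isCongruenceSubgroup_arithmeticLevel_of_le {K : Subgroup (finAdelic F E c N J)}
    (hK : IsCompact (K : Set (finAdelic F E c N J))) {𝔫 : Ideal (𝓞 E)} (h𝔫 : 𝔫 ≠ 0)
    (hnK : finCongruenceLevel F E c N J 𝔫 ≤ K) :
    IsCongruenceSubgroup (c : E →+* E) J (arithmeticLevel F E c N J K) :=
  isCongruenceSubgroup_arithmeticLevel hK
    (Ideal.absNorm_eq_zero_iff.not.2 (by rwa [← Ideal.zero_eq_bot]))
    ((finCongruenceLevel_span_absNorm_le h𝔫).trans hnK)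

omit [NumberField F] in
open Literature.AlgebraicGeometry.ShimuraVarieties in
/-- `Γ(K_{U,f}(𝔫))` is a congruence subgroup for every ideal `𝔫 ≠ 0`. [folklore] -/
theorem isCongruenceSubgroup_arithmeticLevel_finCongruenceLevel {𝔫 : Ideal (𝓞 E)} (h𝔫 : 𝔫 ≠ 0) :
    IsCongruenceSubgroup (c : E →+* E) J (arithmeticLevel F E c N J (finCongruenceLevel F E c N J 𝔫)) :=
  isCongruenceSubgroup_arithmeticLevel_of_le (isCompact_finCongruenceLevel F E c N J h𝔫) h𝔫 le_rfl

omit [NumberField F] in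
open Literature.AlgebraicGeometry.ShimuraVarieties in
/-- **`Γ(K)` is torsion-free for `K ≤ K_{U,f}(n𝓞_E)`, `3 ≤ n`** (Minkowski: `Γ(n)` is torsion-free; tree
`torsionFree_of_le_principalCongruenceSubgroup`). [cite: Minkowski1887, §1] -/
theorem torsionFree_arithmeticLevel {K : Subgroup (finAdelic F E c N J)} {n : ℕ} (hn : 3 ≤ n)
    (hKn : K ≤ finCongruenceLevel F E c N J (Ideal.span {(n : 𝓞 E)})) :
    ∀ γ ∈ arithmeticLevel F E c N J K, IsOfFinOrder γ → γ = 1 :=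
  torsionFree_of_le_principalCongruenceSubgroup hn
    ((arithmeticLevel_mono hKn).trans (arithmeticLevel_finCongruenceLevel_span (by omega)).le)

omit [NumberField F] in
open Literature.AlgebraicGeometry.ShimuraVarieties in
/-- The principal finite congruence levels themselves: `Γ(K_{U,f}(n𝓞_E))`, `3 ≤ n`, is a torsion-free
congruence subgroup. [folklore] -/
theorem isCongruenceSubgroup_torsionFree_principal {n : ℕ} (hn : 3 ≤ n) :
    IsCongruenceSubgroup (c : E →+* E) J
        (arithmeticLevel F E c N J (finCongruenceLevel F E c N J (Ideal.span {(n : 𝓞 E)}))) ∧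
      ∀ γ ∈ arithmeticLevel F E c N J (finCongruenceLevel F E c N J (Ideal.span {(n : 𝓞 E)})),
        IsOfFinOrder γ → γ = 1 := by
  have hn0 : (Ideal.span {(n : 𝓞 E)} : Ideal (𝓞 E)) ≠ 0 := by
    rw [Ne, Ideal.zero_eq_bot, Ideal.span_singleton_eq_bot]; exact_mod_cast (show n ≠ 0 by omega)
  exact ⟨isCongruenceSubgroup_arithmeticLevel (isCompact_finCongruenceLevel F E c N J hn0) (by omega) le_rfl,
    torsionFree_arithmeticLevel hn le_rfl⟩

end UnitaryGroup

/-! ## 6. CM dictionary: the hypothesis shape of `PicardCM.BallQuotientUniformised` -/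

namespace UnitaryGroup

open Literature.AlgebraicGeometry.ShimuraVarieties

variable (E : Subfield ℂ) [NumberField E] [IsCMField E] (N : ℕ) (H : Matrix (Fin N) (Fin N) E)

/-- The ball-quotient datum's `conjRingHom E` is the automorphic side's `(complexConj E : E →+* E)`. [folklore] -/
theorem conjRingHom_eq_coe_complexConj :
    conjRingHom E = ((IsCMField.complexConj E : E ≃ₐ[maximalRealSubfield E] E) : E →+* E) :=
  RingHom.ext fun _ => rfl

/-- **`U(V)(F)` of the ball-quotient datum is `rational E⁺ E c̄ N H`.** [folklore] -/
theorem unitaryGroup_conjRingHom_eq_rational :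
    unitaryGroup (conjRingHom E) H = rational (maximalRealSubfield E) E (IsCMField.complexConj E) N H := by
  rw [unitaryGroup_eq_unitaryGroupOfForm, conjRingHom_eq_coe_complexConj]
  rfl

/-- **CM arithmetic levels are congruence subgroups** in the hypothesis shape of
`PicardCM.BallQuotientUniformised`: `IsCongruenceSubgroup (conjRingHom E) H Γ(K)` for `K` compact
containing `K_{U,f}(n𝓞_E)`, `0 < n`. [cite: PlatonovRapinchuk1994, §4.1] -/
theorem isCongruenceSubgroup_arithmeticLevel_cm
    {K : Subgroup (finAdelic (maximalRealSubfield E) E (IsCMField.complexConj E) N H)}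
    (hK : IsCompact (K : Set (finAdelic (maximalRealSubfield E) E (IsCMField.complexConj E) N H)))
    {n : ℕ} (hn : n ≠ 0)
    (hnK : finCongruenceLevel (maximalRealSubfield E) E (IsCMField.complexConj E) N H (Ideal.span {(n : 𝓞 E)}) ≤ K) :
    IsCongruenceSubgroup (conjRingHom E) H
      (arithmeticLevel (maximalRealSubfield E) E (IsCMField.complexConj E) N H K) := by
  rw [conjRingHom_eq_coe_complexConj]
  exact isCongruenceSubgroup_arithmeticLevel hK hn hnK

/-- **J-U2x (1), CM form: `principalCongruenceSubgroup (conjRingHom E) H n = U(H)(E⁺) ∩ K_{U,f}(n𝓞_E)`**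
(`0 < n`). [cite: PlatonovRapinchuk1994, §4.1] -/
theorem principalCongruenceSubgroup_conjRingHom_eq_arithmeticLevel {n : ℕ} (hn : n ≠ 0) :
    principalCongruenceSubgroup (conjRingHom E) H n =
      arithmeticLevel (maximalRealSubfield E) E (IsCMField.complexConj E) N H
        (finCongruenceLevel (maximalRealSubfield E) E (IsCMField.complexConj E) N H (Ideal.span {(n : 𝓞 E)})) := by
  rw [conjRingHom_eq_coe_complexConj, arithmeticLevel_finCongruenceLevel_span hn]

/-- **CM arithmetic levels are congruence subgroups — ideal-level form** (`K` compact, `K_{U,f}(𝔫) ≤ K`,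
`𝔫 ≠ 0`). [cite: PlatonovRapinchuk1994, §4.1] -/
theorem isCongruenceSubgroup_arithmeticLevel_cm_of_le
    {K : Subgroup (finAdelic (maximalRealSubfield E) E (IsCMField.complexConj E) N H)}
    (hK : IsCompact (K : Set (finAdelic (maximalRealSubfield E) E (IsCMField.complexConj E) N H)))
    {𝔫 : Ideal (𝓞 E)} (h𝔫 : 𝔫 ≠ 0)
    (hnK : finCongruenceLevel (maximalRealSubfield E) E (IsCMField.complexConj E) N H 𝔫 ≤ K) :
    IsCongruenceSubgroup (conjRingHom E) H
      (arithmeticLevel (maximalRealSubfield E) E (IsCMField.complexConj E) N H K) := by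
  rw [conjRingHom_eq_coe_complexConj]
  exact isCongruenceSubgroup_arithmeticLevel_of_le hK h𝔫 hnK

/-- **CM arithmetic levels inside `K_{U,f}(n𝓞_E)`, `3 ≤ n`, are torsion-free.** [cite: Minkowski1887, §1] -/
theorem torsionFree_arithmeticLevel_cm
    {K : Subgroup (finAdelic (maximalRealSubfield E) E (IsCMField.complexConj E) N H)} {n : ℕ} (hn : 3 ≤ n)
    (hKn : K ≤ finCongruenceLevel (maximalRealSubfield E) E (IsCMField.complexConj E) N H (Ideal.span {(n : 𝓞 E)})) :
    ∀ γ ∈ arithmeticLevel (maximalRealSubfield E) E (IsCMField.complexConj E) N H K, IsOfFinOrder γ → γ = 1 :=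
  torsionFree_arithmeticLevel hn hKn

end UnitaryGroup

end Literature.NumberTheory.Automorphic

end
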